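import Summits.BirchSwinnertonDyer.BirchSwinnertonDyer.Theorems.ByReductionTypeAtTwoFineSelmerConjAAtTwoAdditivePotGoodTwoLayerStampsUnramifiedTwo
import HarnessLib

/-!
# Route `ByReductionTypeAtTwo` (rung K4), crux C1″ `FineSelmerConjAAtTwoAdditivePotGood` (item stmt-BirchSwinnertonDyer-22615):
# CLASS NUMBER ONE FOR THE TOTALLY REAL CUBIC FIELD OF DISCRIMINANT `6453 = 3³·239` (`X³ − 18X − 25`) BY AN EXPLICIT MINKOWSKI
# CERTIFICATE (KERNEL) — the `2`-torsion field of the census row `412992bw1` (`2 = 𝔭₁𝔭₂`), whose two-layer stamp thereby drops to ONE bit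
# (a `--supports 22615` file; seat `bsd-2adic-k4-w1` GEN 5; sequel of `…TwoLayerStampsUnramifiedTwo` §4)

HONEST FRAMING (cell `bsd-2adic`, D-0036/D-0054): §1–§2 UNCONDITIONAL kernel arithmetic; §3 conditional on `hLim2` BY NAME and ONE displayed bit
(`e₁ = 0`, i.e. `2 ∤ h(ℚ(θ, √2))`, census `cyc6 = []`); closes nothing at the `∀`-level; nothing booked; BSD is not proved by any of this.

THE CERTIFICATE. `g = X³ − 18X − 25`, `disc g = 6453` (so `d_K = 6453`, `M_K ≤ (4/3.14)(6/27)√6453 < 23`); `g` has no root mod `23` (irreducible,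
`irreducible_cubic_disc_6453`). Roots: mod `2`: `1` (`2 = 𝔭₁𝔭₂`, `X³ + 1 = (X+1)(X²+X+1)`); mod `3`: `1` (`3 = 𝔭³`); mod `5`: `0`; `7`: `1`; `11`: `4`;
`13`: `3`; `17`: `13`; `19`: `13`. Every prime ideal `I` with `N(I) ≤ 22` is principal: `N = 2`: `α = −3 − θ = −(θ−1) − 4`, `N(α) = 2`; `N = 3`:
`α = −2 − θ`, `N = 3`; `N = 4`: `2 ∈ I` and `(θ+1)(θ²−θ+1) = 2(9θ+13)`: `θ + 1 ∈ I` forces the norm-`2` element (absurd), else `α = θ² + θ − 1 =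
(θ²−θ+1) + 2(θ−1) ∈ I`, `N = 4`; `N = 5`: `α = 2θ² − 6θ − 15`, `N = 5`; `N = 7`: `α = θ² − 2θ − 6 = (θ−1)² − 7`, `N = −7`; `N = 11`: `α = −2θ − 3 =
−2(θ−4) − 11`; `N = 13`: `α = θ² − 2θ − 16 = (θ−3)(θ+1) − 13`; `N = 17`: `α = −θ − 4 = −(θ−13) − 17`; `N = 19`: `α = −6θ² − 11θ − 2 =
(θ−13)(−6θ−89) − 19·61`, `N = −19`; `N = 8, 16`: `2 ∈ I` as for `4` (absurd); `N = 9`: `3 ∈ I`, `(θ−1)³ = 3(−θ²+7θ+8)` puts `θ − 1`, hence the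
norm-`3` element, in `I` (absurd); the other `N ≤ 22` are not prime powers.

References: [Marcus1977] Ch. 5 Thm. 35–37; [Cohen1993] §6.3, App. B (totally real cubic fields: d = 6453, h = 1); [Fukuda1994] Thm. 1 (1);
[Lim2017FineSelmer] Thm. 3.5, Lemma 3.2.
-/

set_option autoImplicit false
-- sibling precedent (`…TwoLayerStampsUnramifiedTwo.lean`): the directory name repeats the summit name
set_option linter.dupNamespace false

noncomputable section

open scoped Classical IntermediateField NumberField Real nonZeroDivisors

namespace Summit.BirchSwinnertonDyer.BirchSwinnertonDyer.Theorems.AddKatoTwo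

open WeierstrassCurve Field Polynomial IsDedekindDomain NumberField Matrix Literature.NumberTheory.EllipticCurves
  Literature.NumberTheory.GaloisRepresentations
  Literature.NumberTheory.IwasawaTheory
  Summit.BirchSwinnertonDyer.BirchSwinnertonDyer.Theorems.AlignedTransportAtTwoTorsionPointField
  Summit.BirchSwinnertonDyer.BirchSwinnertonDyer.Theses.ByReductionTypeAtTwo

/-! ## §1 The certificate: `h = 1` for the field of `X³ − 18X − 25` -/

section Certificate

variable (K : Type) [Field K] [NumberField K]

/-- The companion-determinant norms of the nine certificate generators of the field of `X³ − 18X − 25`. -/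
private theorem dets_disc_6453 :
    (((-3 : ℤ) : ℚ) • (1 : Matrix (Fin 3) (Fin 3) ℚ) + ((-1 : ℤ) : ℚ) • !![(0 : ℚ), 0, -(-25 : ℤ); 1, 0, -(-18 : ℤ); 0, 1, -(0 : ℤ)] +
        ((0 : ℤ) : ℚ) • !![(0 : ℚ), 0, -(-25 : ℤ); 1, 0, -(-18 : ℤ); 0, 1, -(0 : ℤ)] ^ 2).det = 2 ∧
    (((-2 : ℤ) : ℚ) • (1 : Matrix (Fin 3) (Fin 3) ℚ) + ((-1 : ℤ) : ℚ) • !![(0 : ℚ), 0, -(-25 : ℤ); 1, 0, -(-18 : ℤ); 0, 1, -(0 : ℤ)] +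
        ((0 : ℤ) : ℚ) • !![(0 : ℚ), 0, -(-25 : ℤ); 1, 0, -(-18 : ℤ); 0, 1, -(0 : ℤ)] ^ 2).det = 3 ∧
    (((-1 : ℤ) : ℚ) • (1 : Matrix (Fin 3) (Fin 3) ℚ) + ((1 : ℤ) : ℚ) • !![(0 : ℚ), 0, -(-25 : ℤ); 1, 0, -(-18 : ℤ); 0, 1, -(0 : ℤ)] +
        ((1 : ℤ) : ℚ) • !![(0 : ℚ), 0, -(-25 : ℤ); 1, 0, -(-18 : ℤ); 0, 1, -(0 : ℤ)] ^ 2).det = 4 ∧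
    (((-15 : ℤ) : ℚ) • (1 : Matrix (Fin 3) (Fin 3) ℚ) + ((-6 : ℤ) : ℚ) • !![(0 : ℚ), 0, -(-25 : ℤ); 1, 0, -(-18 : ℤ); 0, 1, -(0 : ℤ)] +
        ((2 : ℤ) : ℚ) • !![(0 : ℚ), 0, -(-25 : ℤ); 1, 0, -(-18 : ℤ); 0, 1, -(0 : ℤ)] ^ 2).det = 5 ∧
    (((-6 : ℤ) : ℚ) • (1 : Matrix (Fin 3) (Fin 3) ℚ) + ((-2 : ℤ) : ℚ) • !![(0 : ℚ), 0, -(-25 : ℤ); 1, 0, -(-18 : ℤ); 0, 1, -(0 : ℤ)] +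
        ((1 : ℤ) : ℚ) • !![(0 : ℚ), 0, -(-25 : ℤ); 1, 0, -(-18 : ℤ); 0, 1, -(0 : ℤ)] ^ 2).det = -7 ∧
    (((-3 : ℤ) : ℚ) • (1 : Matrix (Fin 3) (Fin 3) ℚ) + ((-2 : ℤ) : ℚ) • !![(0 : ℚ), 0, -(-25 : ℤ); 1, 0, -(-18 : ℤ); 0, 1, -(0 : ℤ)] +
        ((0 : ℤ) : ℚ) • !![(0 : ℚ), 0, -(-25 : ℤ); 1, 0, -(-18 : ℤ); 0, 1, -(0 : ℤ)] ^ 2).det = -11 ∧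
    (((-16 : ℤ) : ℚ) • (1 : Matrix (Fin 3) (Fin 3) ℚ) + ((-2 : ℤ) : ℚ) • !![(0 : ℚ), 0, -(-25 : ℤ); 1, 0, -(-18 : ℤ); 0, 1, -(0 : ℤ)] +
        ((1 : ℤ) : ℚ) • !![(0 : ℚ), 0, -(-25 : ℤ); 1, 0, -(-18 : ℤ); 0, 1, -(0 : ℤ)] ^ 2).det = 13 ∧
    (((-4 : ℤ) : ℚ) • (1 : Matrix (Fin 3) (Fin 3) ℚ) + ((-1 : ℤ) : ℚ) • !![(0 : ℚ), 0, -(-25 : ℤ); 1, 0, -(-18 : ℤ); 0, 1, -(0 : ℤ)] +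
        ((0 : ℤ) : ℚ) • !![(0 : ℚ), 0, -(-25 : ℤ); 1, 0, -(-18 : ℤ); 0, 1, -(0 : ℤ)] ^ 2).det = -17 ∧
    (((-2 : ℤ) : ℚ) • (1 : Matrix (Fin 3) (Fin 3) ℚ) + ((-11 : ℤ) : ℚ) • !![(0 : ℚ), 0, -(-25 : ℤ); 1, 0, -(-18 : ℤ); 0, 1, -(0 : ℤ)] +
        ((-6 : ℤ) : ℚ) • !![(0 : ℚ), 0, -(-25 : ℤ); 1, 0, -(-18 : ℤ); 0, 1, -(0 : ℤ)] ^ 2).det = -19 := by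
  refine ⟨?_, ?_, ?_, ?_, ?_, ?_, ?_, ?_, ?_⟩ <;>
    · simp only [Matrix.one_fin_three, Matrix.det_fin_three, Matrix.add_apply, Matrix.smul_apply, sq, Matrix.mul_apply,
      Fin.sum_univ_three, Matrix.of_apply, Matrix.cons_val', Matrix.cons_val_zero, Matrix.cons_val_one, Matrix.cons_val_two,
      Matrix.head_cons, Matrix.tail_cons, Matrix.empty_val', Matrix.cons_val_fin_one, smul_eq_mul]; norm_num

/-- **`h = 1` for every cubic number field containing a root `θ` of `X³ − 18X − 25`** (the totally real field of discriminant `6453`,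
`2 = 𝔭₁𝔭₂`, `3 = 𝔭³`), by the explicit Minkowski certificate of the module docstring. KERNEL. [cite: Marcus1977, Ch. 5 Thm. 37 and Cor. 2]
[cite: Cohen1993, App. B (totally real cubic fields: d = 6453, h = 1)] -/
theorem classNumber_eq_one_of_root_disc_6453 (h3 : Module.finrank ℚ K = 3) (b : 𝓞 K)
    (hb : b ^ 3 + (0 : ℤ) * b ^ 2 + (-18 : ℤ) * b + (-25 : ℤ) = 0) : NumberField.classNumber K = 1 := by
  have hirr := irreducible_cubic_disc_6453
  have hd : |NumberField.discr K| ≤ (6453 : ℕ) :=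
    (abs_discr_le_abs_cubic_discr K h3 b hirr hb).trans (by simp only [Cubic.discr]; norm_num)
  have hM := minkowskiBound_lt_of_sqrt_le K h3 hd (s := 80.34) (B := 23)
    ((Real.sqrt_le_sqrt (by norm_num : ((6453 : ℕ) : ℝ) ≤ (80.34 : ℝ) ^ 2)).trans (Real.sqrt_sq (by norm_num)).le)
    (by norm_num)
  obtain ⟨hN2, hN3, hN4, hN5, hN7, hN11, hN13, hN17, hN19⟩ := dets_disc_6453
  have hb' : b ^ 3 - 18 * b - 25 = 0 := by push_cast at hb; linear_combination hb
  rw [NumberField.classNumber_eq_one_iff]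
  refine RingOfIntegers.isPrincipalIdealRing_of_isPrincipal_of_norm_le_of_isPrime fun I hI hle ↦ ?_
  have hlt : Ideal.absNorm (I : Ideal (𝓞 K)) < 23 := by exact_mod_cast hle.trans_lt hM
  have h0 : Ideal.absNorm (I : Ideal (𝓞 K)) ≠ 0 := Ideal.absNorm_ne_zero_of_nonZeroDivisors I
  have h1 : Ideal.absNorm (I : Ideal (𝓞 K)) ≠ 1 := by rw [Ne, Ideal.absNorm_eq_one_iff]; exact hI.ne_top
  have hmemN := Ideal.absNorm_mem (I : Ideal (𝓞 K))
  have nα2 := natAbs_norm_coords_eq K h3 b hirr hb (-3) (-1) 0 (n := 2) hN2 (by norm_num)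
  have nα3 := natAbs_norm_coords_eq K h3 b hirr hb (-2) (-1) 0 (n := 3) hN3 (by norm_num)
  have nα4 := natAbs_norm_coords_eq K h3 b hirr hb (-1) 1 1 (n := 4) hN4 (by norm_num)
  have nα5 := natAbs_norm_coords_eq K h3 b hirr hb (-15) (-6) 2 (n := 5) hN5 (by norm_num)
  have nα7 := natAbs_norm_coords_eq K h3 b hirr hb (-6) (-2) 1 (n := 7) hN7 (by norm_num)
  have nα11 := natAbs_norm_coords_eq K h3 b hirr hb (-3) (-2) 0 (n := 11) hN11 (by norm_num)
  have nα13 := natAbs_norm_coords_eq K h3 b hirr hb (-16) (-2) 1 (n := 13) hN13 (by norm_num)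
  have nα17 := natAbs_norm_coords_eq K h3 b hirr hb (-4) (-1) 0 (n := 17) hN17 (by norm_num)
  have nα19 := natAbs_norm_coords_eq K h3 b hirr hb (-2) (-11) (-6) (n := 19) hN19 (by norm_num)
  -- `θ − 1 ∈ I ⟹ α₂ ∈ I` (when `2 ∈ I`) and `⟹ α₃ ∈ I` (when `3 ∈ I`)
  have key2 : ((2 : ℕ) : 𝓞 K) ∈ (I : Ideal (𝓞 K)) → b - 1 ∈ (I : Ideal (𝓞 K)) → (((-3 : ℤ) : 𝓞 K) + ((-1 : ℤ) : 𝓞 K) * b + ((0 : ℤ) : 𝓞 K) * b ^ 2) ∈ (I : Ideal (𝓞 K)) := by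
    intro h2 h
    have : (((-3 : ℤ) : 𝓞 K) + ((-1 : ℤ) : 𝓞 K) * b + ((0 : ℤ) : 𝓞 K) * b ^ 2) = (b - 1) * (-1) + ((2 : ℕ) : 𝓞 K) * (-2) := by push_cast; ring
    rw [this]; exact Ideal.add_mem _ (Ideal.mul_mem_right _ _ h) (Ideal.mul_mem_right _ _ h2)
  have key3 : ((3 : ℕ) : 𝓞 K) ∈ (I : Ideal (𝓞 K)) → b - 1 ∈ (I : Ideal (𝓞 K)) → (((-2 : ℤ) : 𝓞 K) + ((-1 : ℤ) : 𝓞 K) * b + ((0 : ℤ) : 𝓞 K) * b ^ 2) ∈ (I : Ideal (𝓞 K)) := by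
    intro h3m h
    have : (((-2 : ℤ) : 𝓞 K) + ((-1 : ℤ) : 𝓞 K) * b + ((0 : ℤ) : 𝓞 K) * b ^ 2) = (b - 1) * (-1) + ((3 : ℕ) : 𝓞 K) * (-1) := by push_cast; ring
    rw [this]; exact Ideal.add_mem _ (Ideal.mul_mem_right _ _ h) (Ideal.mul_mem_right _ _ h3m)
  have key4 : ((2 : ℕ) : 𝓞 K) ∈ (I : Ideal (𝓞 K)) → b ^ 2 - b + 1 ∈ (I : Ideal (𝓞 K)) → (((-1 : ℤ) : 𝓞 K) + ((1 : ℤ) : 𝓞 K) * b + ((1 : ℤ) : 𝓞 K) * b ^ 2) ∈ (I : Ideal (𝓞 K)) := by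
    intro h2 h
    have : (((-1 : ℤ) : 𝓞 K) + ((1 : ℤ) : 𝓞 K) * b + ((1 : ℤ) : 𝓞 K) * b ^ 2) = (b ^ 2 - b + 1) + ((2 : ℕ) : 𝓞 K) * (b - 1) := by push_cast; ring
    rw [this]; exact Ideal.add_mem _ h (Ideal.mul_mem_right _ _ h2)
  -- `2 ∈ I` ⟹ `N(I) ∣ 2` or `N(I) ∣ 4`
  have htwo : ((2 : ℕ) : 𝓞 K) ∈ (I : Ideal (𝓞 K)) → Ideal.absNorm (I : Ideal (𝓞 K)) ∣ 2 ∨ Ideal.absNorm (I : Ideal (𝓞 K)) ∣ 4 := by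
    intro h2
    have hprod : (b + 1) * (b ^ 2 - b + 1) ∈ (I : Ideal (𝓞 K)) := by
      have : (b + 1) * (b ^ 2 - b + 1) = ((2 : ℕ) : 𝓞 K) * (9 * b + 13) := by push_cast; linear_combination hb'
      rw [this]; exact Ideal.mul_mem_right _ _ h2
    rcases hI.mem_or_mem hprod with h | h
    · left
      have hb1 : b - 1 ∈ (I : Ideal (𝓞 K)) := by
        have : b - 1 = (b + 1) + ((2 : ℕ) : 𝓞 K) * (-1) := by push_cast; ring
        rw [this]; exact Ideal.add_mem _ h (Ideal.mul_mem_right _ _ h2)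
      have hdvd := Ideal.absNorm_dvd_absNorm_of_le ((Ideal.span_singleton_le_iff_mem _).mpr (key2 h2 hb1))
      rwa [Ideal.absNorm_span_singleton, nα2] at hdvd
    · right
      have hdvd := Ideal.absNorm_dvd_absNorm_of_le ((Ideal.span_singleton_le_iff_mem _).mpr (key4 h2 h))
      rwa [Ideal.absNorm_span_singleton, nα4] at hdvd
  have h2le : 2 ≤ Ideal.absNorm (I : Ideal (𝓞 K)) := by omega
  interval_cases hn : Ideal.absNorm (I : Ideal (𝓞 K))
  · -- N(I) = 2: `θ ≡ 1`
    have h2 : ((2 : ℕ) : 𝓞 K) ∈ (I : Ideal (𝓞 K)) := hmemN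
    obtain ⟨a, ha, hab⟩ := exists_sub_natCast_mem_of_absNorm_eq_prime K (by norm_num) hn b
    have hdvd := natCast_dvd_of_sub_mem K (by norm_num) hn h3 hb hab
    interval_cases a
    · norm_num at hdvd
    · exact ⟨⟨_, eq_span_singleton_of_mem_of_absNorm_eq K two_ne_zero hn (key2 h2 (by simpa using hab)) nα2⟩⟩
  · -- N(I) = 3: `θ ≡ 1`
    have h3m : ((3 : ℕ) : 𝓞 K) ∈ (I : Ideal (𝓞 K)) := hmemN
    obtain ⟨a, ha, hab⟩ := exists_sub_natCast_mem_of_absNorm_eq_prime K (by norm_num) hn b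
    have hdvd := natCast_dvd_of_sub_mem K (by norm_num) hn h3 hb hab
    interval_cases a
    · norm_num at hdvd
    · exact ⟨⟨_, eq_span_singleton_of_mem_of_absNorm_eq K (by norm_num) hn (key3 h3m (by simpa using hab)) nα3⟩⟩
    · norm_num at hdvd
  · -- N(I) = 4
    have h4 : ((4 : ℕ) : 𝓞 K) ∈ (I : Ideal (𝓞 K)) := hmemN
    have h2 : ((2 : ℕ) : 𝓞 K) ∈ (I : Ideal (𝓞 K)) := by
      have : ((4 : ℕ) : 𝓞 K) = ((2 : ℕ) : 𝓞 K) * ((2 : ℕ) : 𝓞 K) := by push_cast; norm_num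
      rw [this] at h4; exact (hI.mem_or_mem h4).elim id id
    have hprod : (b + 1) * (b ^ 2 - b + 1) ∈ (I : Ideal (𝓞 K)) := by
      have : (b + 1) * (b ^ 2 - b + 1) = ((2 : ℕ) : 𝓞 K) * (9 * b + 13) := by push_cast; linear_combination hb'
      rw [this]; exact Ideal.mul_mem_right _ _ h2
    rcases hI.mem_or_mem hprod with h | h
    · exfalso
      have hb1 : b - 1 ∈ (I : Ideal (𝓞 K)) := by
        have : b - 1 = (b + 1) + ((2 : ℕ) : 𝓞 K) * (-1) := by push_cast; ring
        rw [this]; exact Ideal.add_mem _ h (Ideal.mul_mem_right _ _ h2)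
      have hdvd := Ideal.absNorm_dvd_absNorm_of_le ((Ideal.span_singleton_le_iff_mem _).mpr (key2 h2 hb1))
      rw [Ideal.absNorm_span_singleton, nα2, hn] at hdvd
      omega
    · exact ⟨⟨_, eq_span_singleton_of_mem_of_absNorm_eq K (by norm_num) hn (key4 h2 h) nα4⟩⟩
  · -- N(I) = 5: `θ ≡ 0`
    have h5m : ((5 : ℕ) : 𝓞 K) ∈ (I : Ideal (𝓞 K)) := hmemN
    obtain ⟨a, ha, hab⟩ := exists_sub_natCast_mem_of_absNorm_eq_prime K (by norm_num) hn b
    have hdvd := natCast_dvd_of_sub_mem K (by norm_num) hn h3 hb hab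
    interval_cases a
    · refine ⟨⟨_, eq_span_singleton_of_mem_of_absNorm_eq K (by norm_num) hn ?_ nα5⟩⟩
      have : (((-15 : ℤ) : 𝓞 K) + ((-6 : ℤ) : 𝓞 K) * b + ((2 : ℤ) : 𝓞 K) * b ^ 2) = (b - ((0 : ℕ) : 𝓞 K)) * (2 * b - 6) + ((5 : ℕ) : 𝓞 K) * (-3) := by push_cast; ring
      rw [this]; exact Ideal.add_mem _ (Ideal.mul_mem_right _ _ hab) (Ideal.mul_mem_right _ _ h5m)
    all_goals norm_num at hdvd
  · -- N(I) = 6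
    exfalso
    have h6 : ((6 : ℕ) : 𝓞 K) ∈ (I : Ideal (𝓞 K)) := hmemN
    have : ((6 : ℕ) : 𝓞 K) = ((2 : ℕ) : 𝓞 K) * ((3 : ℕ) : 𝓞 K) := by push_cast; norm_num
    rw [this] at h6
    rcases hI.mem_or_mem h6 with h | h
    · have := absNorm_dvd_pow_three_of_natCast_mem K h3 h; rw [hn] at this; omega
    · have := absNorm_dvd_pow_three_of_natCast_mem K h3 h; rw [hn] at this; omega
  · -- N(I) = 7: `θ ≡ 1`
    have h7m : ((7 : ℕ) : 𝓞 K) ∈ (I : Ideal (𝓞 K)) := hmemN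
    obtain ⟨a, ha, hab⟩ := exists_sub_natCast_mem_of_absNorm_eq_prime K (by norm_num) hn b
    have hdvd := natCast_dvd_of_sub_mem K (by norm_num) hn h3 hb hab
    interval_cases a
    · norm_num at hdvd
    · refine ⟨⟨_, eq_span_singleton_of_mem_of_absNorm_eq K (by norm_num) hn ?_ nα7⟩⟩
      have : (((-6 : ℤ) : 𝓞 K) + ((-2 : ℤ) : 𝓞 K) * b + ((1 : ℤ) : 𝓞 K) * b ^ 2) = (b - ((1 : ℕ) : 𝓞 K)) * (b - 1) + ((7 : ℕ) : 𝓞 K) * (-1) := by push_cast; ring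
      rw [this]; exact Ideal.add_mem _ (Ideal.mul_mem_right _ _ hab) (Ideal.mul_mem_right _ _ h7m)
    all_goals norm_num at hdvd
  · -- N(I) = 8
    exfalso
    have h8 : ((8 : ℕ) : 𝓞 K) ∈ (I : Ideal (𝓞 K)) := hmemN
    have h2 : ((2 : ℕ) : 𝓞 K) ∈ (I : Ideal (𝓞 K)) := by
      have : ((8 : ℕ) : 𝓞 K) = ((2 : ℕ) : 𝓞 K) * (((2 : ℕ) : 𝓞 K) * ((2 : ℕ) : 𝓞 K)) := by push_cast; norm_num
      rw [this] at h8
      rcases hI.mem_or_mem h8 with h | h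
      · exact h
      · exact (hI.mem_or_mem h).elim id id
    rcases htwo h2 with h | h <;> omega
  · -- N(I) = 9
    exfalso
    have h9 : ((9 : ℕ) : 𝓞 K) ∈ (I : Ideal (𝓞 K)) := hmemN
    have h3m : ((3 : ℕ) : 𝓞 K) ∈ (I : Ideal (𝓞 K)) := by
      have : ((9 : ℕ) : 𝓞 K) = ((3 : ℕ) : 𝓞 K) * ((3 : ℕ) : 𝓞 K) := by push_cast; norm_num
      rw [this] at h9; exact (hI.mem_or_mem h9).elim id id
    have hb1 : b - 1 ∈ (I : Ideal (𝓞 K)) := by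
      apply hI.mem_of_pow_mem 3
      have : (b - 1) ^ 3 = ((3 : ℕ) : 𝓞 K) * (-b ^ 2 + 7 * b + 8) := by push_cast; linear_combination hb'
      rw [this]; exact Ideal.mul_mem_right _ _ h3m
    have hdvd := Ideal.absNorm_dvd_absNorm_of_le ((Ideal.span_singleton_le_iff_mem _).mpr (key3 h3m hb1))
    rw [Ideal.absNorm_span_singleton, nα3, hn] at hdvd
    omega
  · -- N(I) = 10
    exfalso
    have h10 : ((10 : ℕ) : 𝓞 K) ∈ (I : Ideal (𝓞 K)) := hmemN
    have : ((10 : ℕ) : 𝓞 K) = ((2 : ℕ) : 𝓞 K) * ((5 : ℕ) : 𝓞 K) := by push_cast; norm_num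
    rw [this] at h10
    rcases hI.mem_or_mem h10 with h | h
    · have := absNorm_dvd_pow_three_of_natCast_mem K h3 h; rw [hn] at this; omega
    · have := absNorm_dvd_pow_three_of_natCast_mem K h3 h; rw [hn] at this; omega
  · -- N(I) = 11: `θ ≡ 4`
    have h11m : ((11 : ℕ) : 𝓞 K) ∈ (I : Ideal (𝓞 K)) := hmemN
    obtain ⟨a, ha, hab⟩ := exists_sub_natCast_mem_of_absNorm_eq_prime K (by norm_num) hn b
    have hdvd := natCast_dvd_of_sub_mem K (by norm_num) hn h3 hb hab
    interval_cases a
    any_goals norm_num at hdvd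
    refine ⟨⟨_, eq_span_singleton_of_mem_of_absNorm_eq K (by norm_num) hn ?_ nα11⟩⟩
    have : (((-3 : ℤ) : 𝓞 K) + ((-2 : ℤ) : 𝓞 K) * b + ((0 : ℤ) : 𝓞 K) * b ^ 2) = (b - ((4 : ℕ) : 𝓞 K)) * (-2) + ((11 : ℕ) : 𝓞 K) * (-1) := by push_cast; ring
    rw [this]; exact Ideal.add_mem _ (Ideal.mul_mem_right _ _ hab) (Ideal.mul_mem_right _ _ h11m)
  · -- N(I) = 12
    exfalso
    have h12 : ((12 : ℕ) : 𝓞 K) ∈ (I : Ideal (𝓞 K)) := hmemN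
    have : ((12 : ℕ) : 𝓞 K) = ((3 : ℕ) : 𝓞 K) * ((4 : ℕ) : 𝓞 K) := by push_cast; norm_num
    rw [this] at h12
    rcases hI.mem_or_mem h12 with h | h
    · have := absNorm_dvd_pow_three_of_natCast_mem K h3 h; rw [hn] at this; omega
    · have := absNorm_dvd_pow_three_of_natCast_mem K h3 h; rw [hn] at this; omega
  · -- N(I) = 13: `θ ≡ 3`
    have h13m : ((13 : ℕ) : 𝓞 K) ∈ (I : Ideal (𝓞 K)) := hmemN
    obtain ⟨a, ha, hab⟩ := exists_sub_natCast_mem_of_absNorm_eq_prime K (by norm_num) hn b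
    have hdvd := natCast_dvd_of_sub_mem K (by norm_num) hn h3 hb hab
    interval_cases a
    any_goals norm_num at hdvd
    refine ⟨⟨_, eq_span_singleton_of_mem_of_absNorm_eq K (by norm_num) hn ?_ nα13⟩⟩
    have : (((-16 : ℤ) : 𝓞 K) + ((-2 : ℤ) : 𝓞 K) * b + ((1 : ℤ) : 𝓞 K) * b ^ 2) = (b - ((3 : ℕ) : 𝓞 K)) * (b + 1) + ((13 : ℕ) : 𝓞 K) * (-1) := by push_cast; ring
    rw [this]; exact Ideal.add_mem _ (Ideal.mul_mem_right _ _ hab) (Ideal.mul_mem_right _ _ h13m)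
  · -- N(I) = 14
    exfalso
    have h14 : ((14 : ℕ) : 𝓞 K) ∈ (I : Ideal (𝓞 K)) := hmemN
    have : ((14 : ℕ) : 𝓞 K) = ((2 : ℕ) : 𝓞 K) * ((7 : ℕ) : 𝓞 K) := by push_cast; norm_num
    rw [this] at h14
    rcases hI.mem_or_mem h14 with h | h
    · have := absNorm_dvd_pow_three_of_natCast_mem K h3 h; rw [hn] at this; omega
    · have := absNorm_dvd_pow_three_of_natCast_mem K h3 h; rw [hn] at this; omega
  · -- N(I) = 15
    exfalso
    have h15 : ((15 : ℕ) : 𝓞 K) ∈ (I : Ideal (𝓞 K)) := hmemN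
    have : ((15 : ℕ) : 𝓞 K) = ((3 : ℕ) : 𝓞 K) * ((5 : ℕ) : 𝓞 K) := by push_cast; norm_num
    rw [this] at h15
    rcases hI.mem_or_mem h15 with h | h
    · have := absNorm_dvd_pow_three_of_natCast_mem K h3 h; rw [hn] at this; omega
    · have := absNorm_dvd_pow_three_of_natCast_mem K h3 h; rw [hn] at this; omega
  · -- N(I) = 16
    exfalso
    have h16 : ((16 : ℕ) : 𝓞 K) ∈ (I : Ideal (𝓞 K)) := hmemN
    have h2 : ((2 : ℕ) : 𝓞 K) ∈ (I : Ideal (𝓞 K)) := by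
      have : ((16 : ℕ) : 𝓞 K) = ((2 : ℕ) : 𝓞 K) * (((2 : ℕ) : 𝓞 K) * (((2 : ℕ) : 𝓞 K) * ((2 : ℕ) : 𝓞 K))) := by push_cast; norm_num
      rw [this] at h16
      rcases hI.mem_or_mem h16 with h | h
      · exact h
      rcases hI.mem_or_mem h with h | h
      · exact h
      · exact (hI.mem_or_mem h).elim id id
    rcases htwo h2 with h | h <;> omega
  · -- N(I) = 17: `θ ≡ 13`
    have h17m : ((17 : ℕ) : 𝓞 K) ∈ (I : Ideal (𝓞 K)) := hmemN
    obtain ⟨a, ha, hab⟩ := exists_sub_natCast_mem_of_absNorm_eq_prime K (by norm_num) hn b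
    have hdvd := natCast_dvd_of_sub_mem K (by norm_num) hn h3 hb hab
    interval_cases a
    any_goals norm_num at hdvd
    refine ⟨⟨_, eq_span_singleton_of_mem_of_absNorm_eq K (by norm_num) hn ?_ nα17⟩⟩
    have : (((-4 : ℤ) : 𝓞 K) + ((-1 : ℤ) : 𝓞 K) * b + ((0 : ℤ) : 𝓞 K) * b ^ 2) = (b - ((13 : ℕ) : 𝓞 K)) * (-1) + ((17 : ℕ) : 𝓞 K) * (-1) := by push_cast; ring
    rw [this]; exact Ideal.add_mem _ (Ideal.mul_mem_right _ _ hab) (Ideal.mul_mem_right _ _ h17m)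
  · -- N(I) = 18
    exfalso
    have h18 : ((18 : ℕ) : 𝓞 K) ∈ (I : Ideal (𝓞 K)) := hmemN
    have : ((18 : ℕ) : 𝓞 K) = ((2 : ℕ) : 𝓞 K) * ((9 : ℕ) : 𝓞 K) := by push_cast; norm_num
    rw [this] at h18
    rcases hI.mem_or_mem h18 with h | h
    · have := absNorm_dvd_pow_three_of_natCast_mem K h3 h; rw [hn] at this; omega
    · have := absNorm_dvd_pow_three_of_natCast_mem K h3 h; rw [hn] at this; omega
  · -- N(I) = 19: `θ ≡ 13`
    have h19m : ((19 : ℕ) : 𝓞 K) ∈ (I : Ideal (𝓞 K)) := hmemN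
    obtain ⟨a, ha, hab⟩ := exists_sub_natCast_mem_of_absNorm_eq_prime K (by norm_num) hn b
    have hdvd := natCast_dvd_of_sub_mem K (by norm_num) hn h3 hb hab
    interval_cases a
    any_goals norm_num at hdvd
    refine ⟨⟨_, eq_span_singleton_of_mem_of_absNorm_eq K (by norm_num) hn ?_ nα19⟩⟩
    have : (((-2 : ℤ) : 𝓞 K) + ((-11 : ℤ) : 𝓞 K) * b + ((-6 : ℤ) : 𝓞 K) * b ^ 2) = (b - ((13 : ℕ) : 𝓞 K)) * (-6 * b - 89) + ((19 : ℕ) : 𝓞 K) * (-61) := by push_cast; ring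
    rw [this]; exact Ideal.add_mem _ (Ideal.mul_mem_right _ _ hab) (Ideal.mul_mem_right _ _ h19m)
  · -- N(I) = 20
    exfalso
    have h20 : ((20 : ℕ) : 𝓞 K) ∈ (I : Ideal (𝓞 K)) := hmemN
    have : ((20 : ℕ) : 𝓞 K) = ((4 : ℕ) : 𝓞 K) * ((5 : ℕ) : 𝓞 K) := by push_cast; norm_num
    rw [this] at h20
    rcases hI.mem_or_mem h20 with h | h
    · have := absNorm_dvd_pow_three_of_natCast_mem K h3 h; rw [hn] at this; omega
    · have := absNorm_dvd_pow_three_of_natCast_mem K h3 h; rw [hn] at this; omega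
  · -- N(I) = 21
    exfalso
    have h21 : ((21 : ℕ) : 𝓞 K) ∈ (I : Ideal (𝓞 K)) := hmemN
    have : ((21 : ℕ) : 𝓞 K) = ((3 : ℕ) : 𝓞 K) * ((7 : ℕ) : 𝓞 K) := by push_cast; norm_num
    rw [this] at h21
    rcases hI.mem_or_mem h21 with h | h
    · have := absNorm_dvd_pow_three_of_natCast_mem K h3 h; rw [hn] at this; omega
    · have := absNorm_dvd_pow_three_of_natCast_mem K h3 h; rw [hn] at this; omega
  · -- N(I) = 22
    exfalso
    have h22 : ((22 : ℕ) : 𝓞 K) ∈ (I : Ideal (𝓞 K)) := hmemN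
    have : ((22 : ℕ) : 𝓞 K) = ((2 : ℕ) : 𝓞 K) * ((11 : ℕ) : 𝓞 K) := by push_cast; norm_num
    rw [this] at h22
    rcases hI.mem_or_mem h22 with h | h
    · have := absNorm_dvd_pow_three_of_natCast_mem K h3 h; rw [hn] at this; omega
    · have := absNorm_dvd_pow_three_of_natCast_mem K h3 h; rw [hn] at this; omega

end Certificate

/-! ## §2 `ℚ(θ)`: class number one -/

/-- `#Cl(𝓞 ℚ(θ)) = 1` for every root `θ` of `X³ − 18X − 25`. KERNEL. [cite: Cohen1993, App. B (d = 6453)] -/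
theorem card_classGroup_adjoin_eq_one_disc_6453 {θ : AlgebraicClosure ℚ}
    (hθ : aeval θ (Cubic.toPoly ⟨1, ((0 : ℤ) : ℚ), ((-18 : ℤ) : ℚ), ((-25 : ℤ) : ℚ)⟩) = 0) :
    Nat.card (ClassGroup (𝓞 (IntermediateField.adjoin ℚ {θ}))) = 1 := by
  have hfm : (Cubic.toPoly ⟨1, ((0 : ℤ) : ℚ), ((-18 : ℤ) : ℚ), ((-25 : ℤ) : ℚ)⟩).Monic := Cubic.monic_of_a_eq_one'
  have hθint : IsIntegral ℚ θ := ⟨_, hfm, by rwa [← aeval_def]⟩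
  haveI : FiniteDimensional ℚ (IntermediateField.adjoin ℚ {θ}) := IntermediateField.adjoin.finiteDimensional hθint
  haveI : NumberField (IntermediateField.adjoin ℚ {θ}) := NumberField.mk
  obtain ⟨b, -, hb⟩ := exists_ringOfIntegers_cubic_root (p := 0) (q := -18) (r := -25) hθ
  have h1 := classNumber_eq_one_of_root_disc_6453 _
    (finrank_adjoin_eq_three_of_irreducible irreducible_cubic_disc_6453 hθ) b hb
  rw [NumberField.classNumber, ← Nat.card_eq_fintype_card] at h1
  exact h1

/-! ## §3 The stamp of `412992bw1`, now from ONE bit -/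

/-- **(A)₂ for `412992bw1` from ONE parity bit** — `…TwoLayerStampsUnramifiedTwo`'s `conjA_two_412992bw1_of_twoBits` with the first bit
(`2 ∤ #Cl(𝓞 ℚ(θ))`) DISCHARGED by §2 (`h = 1`, kernel). Granted `hLim2`; displayed: «`e₁ = 0`» = `2 ∤ h(ℚ(θ, √2))` (census `cyc6 = []`).
[cite: Lim2017FineSelmer, §3 Thm. 3.5 and Lemma 3.2] [cite: Fukuda1994, Thm. 1 (1), p. 264] [cite: Cohen1993, App. B (d = 6453)] -/
theorem conjA_two_412992bw1_of_layerOneBit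
    (hLim2 : Lim2017.thm35_at_two_fineSelmerDual_moduleFinite_of_classicalMuVanishes_of_le_divisionField_four)
    {θ : AlgebraicClosure ℚ} (hθ : aeval θ (Cubic.toPoly ⟨1, ((0 : ℤ) : ℚ), ((-18 : ℤ) : ℚ), ((-25 : ℤ) : ℚ)⟩) = 0)
    (h1 : haveI : FiniteDimensional ℚ (IntermediateField.adjoin ℚ {θ}) :=
        IntermediateField.adjoin.finiteDimensional ((AlgebraicClosure.isAlgebraic ℚ).isAlgebraic θ).isIntegral
      haveI : NumberField (IntermediateField.adjoin ℚ {θ}) := NumberField.mk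
      ∀ κL : ZpExtension (IntermediateField.adjoin ℚ {θ}) 2, κL.IsCyclotomic → classNumberPExp κL 1 = 0)
    (κ : ZpExtension ℚ 2) (hκ : κ.IsCyclotomic) :
    haveI := isElliptic_412992bw1'
    ∃ (γ : absoluteGaloisGroup ℚ) (D : (⟨0, ((0 : ℤ) : ℚ), 0, ((-43798121268 : ℤ) : ℚ), ((-3528022418672640 : ℤ) : ℚ)⟩ :
        WeierstrassCurve ℚ).FineSelmerDualData κ γ),
      Module.Finite ℤ_[2] (RestrictScalars ℤ_[2] (IwasawaAlgebra 2) D.X) :=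
  conjA_two_412992bw1_of_twoBits hLim2 hθ (by rw [card_classGroup_adjoin_eq_one_disc_6453 hθ]; norm_num) h1 κ hκ

end Summit.BirchSwinnertonDyer.BirchSwinnertonDyer.Theorems.AddKatoTwo

end
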